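import Literature.MathematicalPhysics.QuantumFieldTheory.Balaban1983to89.T4CouplingAnalyticity

/-!
# T⁴ programme, spine estimate NE9 (node U3, history side) — HOLOMORPHY IN THE COUPLINGS PROPAGATES THROUGH THE RECURSION
# QUALITATIVELY: [H-dil] for the LAST coupling (values in the inductive class) + a step that is holomorphic in the old data and
# REPRODUCES the inductive class ⇒ relative-disc holomorphy of EVERY scale-`j` activity in EVERY young coupling with the inductive
# bound — no Lipschitz constant of the step, no transfer coefficient, no contraction rate, no smallness clause
# (census item C29b of cell `pub-balaban-gaps`, seat ne9, gen 5; companion of `Spine/NE9/TowerCarriersBox`)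

Cell `pub-balaban-gaps` (YM blitz G2, seat ne9, unit `pub-balaban-gaps-ne9-g5`; record `run/shared/lean/pub/pub-balaban-gaps/ne/NE9.md` §5 rows
C29∕C29b).  Summits-side bookkeeping at the NORM LEVEL of the NE9 owner lineage's `T4CouplingAnalyticity` §3–§4 (cell `pub-balaban`,
`b2b-balaban-t4-ne9-p1` GEN 3–4): activities `V j g : F` in an abstract complete normed ℂ-space, the step `V (j+1) g = Φ j (g_j) (T j (V · g))`
through transported old data `T j`, and the evaluation `ne9_of_normNE9` to `T4OutputRate.NE9`.  By-name inputs: `BoxWindow`, `hybrid`,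
`hybrid_zero`∕`hybrid_apply_lt`∕`update_hybrid_self`∕`hybrid_succ`∕`hybrid_mem_boxWindow`∕`update_mem_boxWindow`, `NormNE9`, `ne9_of_normNE9`
(`T4CouplingAnalyticity`) and `Dimock2015.real_param_lipschitz` (Cauchy on a margin).  ONE parametric proposition is defined
(`NormCouplingAnalyticRel` — the norm-level twin of the owner's `CouplingAnalyticRel`); nothing is asserted.

WHY.  Row C29 (`TowerCarriersBox.summable_delta_of_analyticBranch`) closes node U3 → U6, GIVEN tower-NE5, from relative-disc holomorphy of
every scale-`m` term in EVERY young coupling with one bound (`CouplingAnalyticRel` at every level).  For the LAST coupling that hypothesis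
is the owner lineage's located [H-dil] (GAPS G-ne9p1-6∕-7: the last coupling is a dilation parameter of [Balaban1987RG1] (2.10) p. 267).  For an
OLDER coupling `g_i`, `i < j − 1`, the located structure (L1)∕(L4) of `T4CouplingAnalyticity` says the dependence is INHERITED: `g_i` enters
`E^{(j)}` only through the old terms, which the printed step uses as data of the inductive class ([Balaban1988RG2Cluster] (2.15) p. 15:
through `|V_k(Y, B)|` only).  The owner lineage's §4 (`stepTransfer_of_analytic`) turned this into CONSTANTS — (AN-LAST) margin `r`, (AN-OLD)
margin `ϱ` and bound `M₂`, the contraction (CONTR) `ω₀` — producing geometric moduli with rate `μ = ω₀ + 4M₂∕ϱ` and the smallness W4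
`μ < 1`.  GIVEN tower-NE5 none of these constants is needed (C24: bounded moduli suffice), and THIS FILE shows that not even the Lipschitz
STRUCTURE of the step in the old data is needed: holomorphy propagates QUALITATIVELY.  If (i) every activity of a real admissible history lies
in an inductive class `A m ⊆ {‖·‖ ≤ B m}` ((1.18) with Thm 3 of [I]: the class reproduces along the real recursion), (ii) the step at a REAL
last coupling is holomorphic in the transported old data on a set containing the transports of ALL class-valued families and maps them
into the next class ((AN-OLD) QUALITATIVE + REPRODUCTION — the TYPE of [I] Thm 3 p. 264 read on the complex inductive spaces; inspection-level
per (L4)), (iii) at the real old data the step is holomorphic in a COMPLEX last coupling on the relative discs `|z − s| ≤ c·|s|` with values in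
the next class ([H-dil]-STEP, H∃), and (iv) the transport is holomorphy-preserving and reads only the levels `≤ j` (e.g. the LINEAR channel of
`contracts_of_sum`), then (`normCouplingAnalyticRel_of_propagation`) EVERY activity `V j` is, in EVERY young coupling `i < j` separately
(the others real in the box), the restriction of a holomorphic `F`-valued function on the relative discs with values in `A j` — hence bounded by
`B j`.  Proof: induction on the level; complexify coordinate `i` at level `i + 1` by (iii), push it through the later REAL-coupling steps by
(ii)∘(iv); classes reproduce, so bounds reproduce; no estimate is ever made.  Then Cauchy on the margin `c·t₀` of a box `I ⊆ [t₀, ∞[`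
(`real_param_lipschitz`) and telescoping through the hybrid histories give `NormNE9 V (BoxWindow I) (4·B j∕(c·t₀))`
(`normNE9_of_normCouplingAnalyticRel`) — BOUNDED, NON-FADING, level-wise moduli — and the owner's evaluation gives `T4OutputRate.NE9` for
the functional (`ne9_boxWindow_of_propagation`) — run by run, this is literally the `h9` input `TowerCarriersBox.TowerNE9On T E I κ (4B̄∕(c t₀))`
of `TowerCarriersBox.summable_delta_of_towerOn_bounded` (the junction is typed in `TowerCarriersBoxWitness` §5, which imports both files).

CONSEQUENCE FOR THE ROW (bookkeeping, nothing of Bałaban's asserted): GIVEN tower-NE5, the E-side obligation list of node U3 → U6 on the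
analytic branch is {[H-dil]-STEP for the LAST coupling with values in the inductive class (H∃ — print names no domain: [I] p. 266
*"analytic functions of the effective coupling constants"*), qualitative holomorphy of the step in the old data (inspection-level, (L4)),
reproduction of the inductive class (PRINTED TYPE: [I] Thm 3; for the complexified families = the H∃ part)} — the W1-internal constants
(AN-OLD)-margin∕bound, (CONTR), the rate gap W4 and clause N2 do not occur.  Classification of NE9 UNCHANGED in kind (instance 0∕1: the step
`Φ`, the classes `A`, the transport `T` for Bałaban's `E^{(j)}` ARE the one-step object W1).

HONEST FRAMING: bookkeeping for rung (B)+1 on ONE FIXED finite four-torus; complex analysis on hypothesis SHAPES; [H-dil], (AN-OLD), the class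
reproduction for complexified couplings are NOT PRINTED as theorems and NOT PROVED for Bałaban's step; NE9 NOT PRINTED ∕ NOT PROVED; spine
PROVED 0∕9 unchanged; NOT UV stability, NOT the continuum limit, NOT infinite volume, NOT a mass gap, NOT Clay.  HONEST DEPENDENCY: continuum
YM on T⁴ ⇐ BetaPertH ∧ nine spine estimates (0∕9 proved); BetaPertH ⇐ (D1) ∧ (D4) ∧ CAP+tail.

References (TYPES only): [Balaban1987RG1] = T. Bałaban, Commun. Math. Phys. **109** (1987) 249–301, (1.18) p. 263, Thm 3 p. 264, p. 266, (2.10)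
p. 267; [Balaban1988RG2Cluster] = T. Bałaban, Commun. Math. Phys. **116** (1988) 1–22, (2.15) p. 15, p. 22; the Cauchy-on-a-margin step is
[Dimock2015] = J. Dimock, arXiv:1512.04373, Sect. 7 (tree module `Dimock2015.AnalyticLipschitz`).
-/

namespace Summit.QuantumFields.BalabanUV.T4Continuum.NE9.AnalyticBranchPropagation

open Metric Set
open scoped BigOperators
open Literature.MathematicalPhysics.QuantumFieldTheory.Balaban1983to89
open Literature.MathematicalPhysics.QuantumFieldTheory.Balaban1983to89.T4OutputRate
open Literature.MathematicalPhysics.QuantumFieldTheory.Balaban1983to89.T4CouplingAnalyticity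
open Literature.MathematicalPhysics.QuantumFieldTheory.Dimock2015 (real_param_lipschitz)

variable {F : Type*} [NormedAddCommGroup F] [NormedSpace ℂ F]

/-! ## §1 The norm-level [H-dil] shape in every young coupling -/

/-- HYPOTHESIS∕CONCLUSION SHAPE (NOT PRINTED): NORM-LEVEL RELATIVE-DISC HOLOMORPHY IN EVERY YOUNG COUPLING — for every level `j`, admissible
history `h ∈ BoxWindow I` and coordinate `i < j`, the activity `s ↦ V j (h[i := s])` on `I` is the restriction of an `F`-valued function
holomorphic on a set containing the closed discs `|z − s| ≤ c·|s|` about the points of `I`, bounded there by `B j`.  The norm-level twin of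
the owner lineage's `T4CouplingAnalyticity.CouplingAnalyticRel` (which is this for the scalar evaluations, with `B j·e^{−κd}`); print has only
[Balaban1987RG1] p. 263 *"(or analytic)"* (last coupling) and p. 266 *"analytic functions of the effective coupling constants"* (no domain,
no bound). [folklore] -/
def NormCouplingAnalyticRel (I : Set ℝ) (V : ℕ → (ℕ → ℝ) → F) (B : ℕ → ℝ) (c : ℝ) : Prop :=
  ∀ j, ∀ h ∈ BoxWindow I, ∀ i < j,
    ∃ (W : ℂ → F) (D : Set ℂ), DifferentiableOn ℂ W D ∧ (∀ z ∈ D, ‖W z‖ ≤ B j) ∧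
      (∀ s ∈ I, closedBall (s : ℂ) (c * |s|) ⊆ D) ∧ (∀ s ∈ I, W s = V j (Function.update h i s))

/-! ## §2 Propagation: [H-dil]-step + holomorphic, class-reproducing step in the old data ⇒ [H-dil] in every young coupling -/

section Propagation

variable {I : Set ℝ} {V : ℕ → (ℕ → ℝ) → F} {Φ : ℕ → ℂ → F → F} {T : ℕ → (ℕ → F) → F} {A : ℕ → Set F} {c : ℝ}

/-- **THE PROPAGATION LEMMA** (induction on the level).  Hypotheses (all SHAPES, displayed): `hP` prefix dependence (printed in words,
[I] p. 256); `hmem` every activity of a real admissible history lies in the inductive class `A m` ((1.18) + Thm 3, real couplings); `hrec` the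
recursion through transported old data; `hTdep`∕`hT` the transport reads the levels `≤ j` only and preserves holomorphy of families (e.g. a
finite sum of continuous linear maps); `hold` at every REAL last coupling `s ∈ I` the step is holomorphic in the old data on a set containing
the transports of ALL class-valued families and maps them into `A (j+1)` ((AN-OLD) qualitative + class REPRODUCTION); `hlast` at the real old
data of an admissible history the step is holomorphic in a COMPLEX last coupling on a set containing the relative discs about `I`, with values
in `A (j+1)` ([H-dil]-STEP).  Conclusion: for every level `j`, admissible `h` and `i < j` there are a set `D ⊇` the relative discs about `I` and
a family `W m : ℂ → F`, `m ≤ j`, of holomorphic functions on `D` with values in `A m` restricting on `I` to `s ↦ V m (h[i := s])` — the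
complexification of coupling `i` pushed through the levels `i+1, …, j`.  No estimate is made anywhere. [folklore] -/
theorem propagate
    (hP : ∀ m, ∀ g ∈ BoxWindow I, ∀ g' ∈ BoxWindow I, (∀ n < m, g n = g' n) → V m g = V m g')
    (hmem : ∀ m, ∀ g ∈ BoxWindow I, V m g ∈ A m)
    (hrec : ∀ j, ∀ g ∈ BoxWindow I, V (j + 1) g = Φ j (g j : ℂ) (T j fun m => V m g))
    (hTdep : ∀ j (a a' : ℕ → F), (∀ m ≤ j, a m = a' m) → T j a = T j a')
    (hT : ∀ j (D : Set ℂ) (W : ℕ → ℂ → F), (∀ m ≤ j, DifferentiableOn ℂ (W m) D) →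
      DifferentiableOn ℂ (fun z => T j fun m => W m z) D)
    (hold : ∀ j, ∀ s ∈ I, ∃ U : Set F, DifferentiableOn ℂ (Φ j (s : ℂ)) U ∧
      ∀ a : ℕ → F, (∀ m ≤ j, a m ∈ A m) → T j a ∈ U ∧ Φ j (s : ℂ) (T j a) ∈ A (j + 1))
    (hlast : ∀ j, ∀ h ∈ BoxWindow I, ∃ D : Set ℂ, DifferentiableOn ℂ (fun z => Φ j z (T j fun m => V m h)) D ∧
      (∀ z ∈ D, Φ j z (T j fun m => V m h) ∈ A (j + 1)) ∧ ∀ s ∈ I, closedBall (s : ℂ) (c * |s|) ⊆ D) :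
    ∀ j, ∀ h ∈ BoxWindow I, ∀ i < j, ∃ (D : Set ℂ) (W : ℕ → ℂ → F),
      (∀ s ∈ I, closedBall (s : ℂ) (c * |s|) ⊆ D) ∧
        ∀ m ≤ j, DifferentiableOn ℂ (W m) D ∧ (∀ z ∈ D, W m z ∈ A m) ∧
          (∀ s ∈ I, W m s = V m (Function.update h i s)) := by
  intro j
  induction j with
  | zero => intro h _ i hi; exact absurd hi (Nat.not_lt_zero i)
  | succ j ih =>
    intro h hh i hi
    rcases Nat.lt_succ_iff_lt_or_eq.mp hi with hij | rfl
    · -- coordinate `i` already complexified at level ≤ j: push through the REAL-coupling step j → j+1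
      obtain ⟨D, W, hdisc, hW⟩ := ih h hh i hij
      obtain ⟨U, hU, hUa⟩ := hold j (h j) (hh j)
      refine ⟨D, fun m => if m ≤ j then W m else fun z => Φ j (h j : ℂ) (T j fun n => W n z), hdisc, ?_⟩
      intro m hm
      rcases Nat.lt_succ_iff_lt_or_eq.mp (Nat.lt_succ_of_le hm) with hmj | rfl
      · have hmj' : m ≤ j := Nat.lt_succ_iff.mp hmj
        simp only [if_pos hmj']
        exact hW m hmj'
      · simp only [if_neg (Nat.not_succ_le_self j)]
        have hadm : ∀ z ∈ D, ∀ n ≤ j, (fun n => W n z) n ∈ A n := fun z hz n hn => (hW n hn).2.1 z hz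
        refine ⟨?_, ?_, ?_⟩
        · -- holomorphy: Φ j (h j) ∘ (z ↦ T j (W · z)), transports of class-valued families stay in U
          have hTj : DifferentiableOn ℂ (fun z => T j fun n => W n z) D :=
            hT j D W fun n hn => (hW n hn).1
          exact hU.comp hTj fun z hz => (hUa _ (hadm z hz)).1
        · -- class reproduction
          intro z hz
          exact (hUa _ (hadm z hz)).2
        · -- agreement on the real segment: the recursion at the updated history
          intro s hs
          have hus : Function.update h i s ∈ BoxWindow I := update_mem_boxWindow hh i hs
          have hne : (j : ℕ) ≠ i := Nat.ne_of_gt hij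
          show Φ j (h j : ℂ) (T j fun n => W n s) = V (j + 1) (Function.update h i s)
          rw [hrec j _ hus, Function.update_of_ne hne]
          congr 1
          exact hTdep j _ _ fun n hn => (hW n hn).2.2 s hs
    · -- `i = j` (after `rfl`, the level is named `i`): complexify the LAST coupling at level i+1 by [H-dil]-step; the older levels
      -- do not see coordinate i
      obtain ⟨D, hD, hA, hdisc⟩ := hlast i h hh
      have hold_eq : ∀ m ≤ i, ∀ s ∈ I, V m h = V m (Function.update h i s) := by
        intro m hm s hs
        exact hP m h hh _ (update_mem_boxWindow hh i hs) fun n hn =>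
          (Function.update_of_ne (Nat.ne_of_lt (lt_of_lt_of_le hn hm)) _ _).symm
      refine ⟨D, fun m => if m ≤ i then fun _ => V m h else fun z => Φ i z (T i fun n => V n h), hdisc, ?_⟩
      intro m hm
      rcases Nat.lt_succ_iff_lt_or_eq.mp (Nat.lt_succ_of_le hm) with hmi | rfl
      · have hmi' : m ≤ i := Nat.lt_succ_iff.mp hmi
        simp only [if_pos hmi']
        exact ⟨differentiableOn_const _, fun z _ => hmem m h hh, fun s hs => hold_eq m hmi' s hs⟩
      · simp only [if_neg (Nat.not_succ_le_self i)]
        refine ⟨hD, hA, fun s hs => ?_⟩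
        have hus : Function.update h i s ∈ BoxWindow I := update_mem_boxWindow hh i hs
        show Φ i (s : ℂ) (T i fun n => V n h) = V (i + 1) (Function.update h i s)
        rw [hrec i _ hus, Function.update_self]
        congr 1
        exact hTdep i _ _ fun n hn => hold_eq n hn s hs

/-- **[H-dil]-STEP + HOLOMORPHIC CLASS-REPRODUCING STEP ⇒ [H-dil] IN EVERY YOUNG COUPLING WITH THE INDUCTIVE BOUND** (norm level): under
the hypotheses of `propagate` and the inductive bound `A m ⊆ {‖·‖ ≤ B m}`, `NormCouplingAnalyticRel I V B c`.  NO Lipschitz constant of the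
step, NO transfer coefficient, NO contraction rate, NO smallness clause is used — only that the class REPRODUCES (the TYPE of
[Balaban1987RG1] Thm 3) and qualitative holomorphy. [folklore] -/
theorem normCouplingAnalyticRel_of_propagation {B : ℕ → ℝ}
    (hAB : ∀ m, ∀ a ∈ A m, ‖a‖ ≤ B m)
    (hP : ∀ m, ∀ g ∈ BoxWindow I, ∀ g' ∈ BoxWindow I, (∀ n < m, g n = g' n) → V m g = V m g')
    (hmem : ∀ m, ∀ g ∈ BoxWindow I, V m g ∈ A m)
    (hrec : ∀ j, ∀ g ∈ BoxWindow I, V (j + 1) g = Φ j (g j : ℂ) (T j fun m => V m g))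
    (hTdep : ∀ j (a a' : ℕ → F), (∀ m ≤ j, a m = a' m) → T j a = T j a')
    (hT : ∀ j (D : Set ℂ) (W : ℕ → ℂ → F), (∀ m ≤ j, DifferentiableOn ℂ (W m) D) →
      DifferentiableOn ℂ (fun z => T j fun m => W m z) D)
    (hold : ∀ j, ∀ s ∈ I, ∃ U : Set F, DifferentiableOn ℂ (Φ j (s : ℂ)) U ∧
      ∀ a : ℕ → F, (∀ m ≤ j, a m ∈ A m) → T j a ∈ U ∧ Φ j (s : ℂ) (T j a) ∈ A (j + 1))
    (hlast : ∀ j, ∀ h ∈ BoxWindow I, ∃ D : Set ℂ, DifferentiableOn ℂ (fun z => Φ j z (T j fun m => V m h)) D ∧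
      (∀ z ∈ D, Φ j z (T j fun m => V m h) ∈ A (j + 1)) ∧ ∀ s ∈ I, closedBall (s : ℂ) (c * |s|) ⊆ D) :
    NormCouplingAnalyticRel I V B c := by
  intro j h hh i hi
  obtain ⟨D, W, hdisc, hW⟩ := propagate hP hmem hrec hTdep hT hold hlast j h hh i hi
  obtain ⟨hWd, hWA, hWs⟩ := hW j le_rfl
  exact ⟨W j, D, hWd, fun z hz => hAB j _ (hWA z hz), hdisc, hWs⟩

/-- NON-VACUITY OF THE TRANSPORT HYPOTHESES: the LINEAR channel `T j a = Σ_{m ≤ j} L j m (a m)` of the owner lineage's `contracts_of_sum`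
(continuous ℂ-linear maps `L j m`) reads the levels `≤ j` only and preserves holomorphy of families. [folklore] -/
theorem linearTransport_hyps (L : ℕ → ℕ → (F →L[ℂ] F)) :
    (∀ j (a a' : ℕ → F), (∀ m ≤ j, a m = a' m) →
        (∑ m ∈ Finset.range (j + 1), L j m (a m)) = ∑ m ∈ Finset.range (j + 1), L j m (a' m)) ∧
      ∀ j (D : Set ℂ) (W : ℕ → ℂ → F), (∀ m ≤ j, DifferentiableOn ℂ (W m) D) →
        DifferentiableOn ℂ (fun z => ∑ m ∈ Finset.range (j + 1), L j m (W m z)) D := by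
  refine ⟨fun j a a' ha => Finset.sum_congr rfl fun m hm => ?_, fun j D W hW => ?_⟩
  · rw [ha m (Nat.lt_succ_iff.mp (Finset.mem_range.mp hm))]
  · refine DifferentiableOn.fun_sum fun m hm => ?_
    exact ((L j m).differentiable.comp_differentiableOn (hW m (Nat.lt_succ_iff.mp (Finset.mem_range.mp hm))))

end Propagation

/-! ## §3 Cauchy on the margin of a coupling box bounded below ⇒ bounded, non-fading history moduli -/

section Cauchy

variable [CompleteSpace F]

/-- **NORM-LEVEL [H-dil] IN EVERY YOUNG COUPLING ⇒ `NormNE9` WITH BOUNDED MODULI `4·B j∕(c·t₀)`** over an order-connected box `I ⊆ [t₀, ∞[`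
(`t₀ > 0`, `c > 0`): the relative discs contain the uniform margin `c·t₀`, Cauchy on that margin (`Dimock2015.real_param_lipschitz`)
bounds each one-coordinate variation, and telescoping through the hybrid histories (all in the box) with the prefix dependence gives
`‖V j g − V j g'‖ ≤ Σ_{i<j} (4B j∕(c t₀))·|g_i − g'_i|`.  The owner lineage's `ne9T_of_couplingAnalyticRel` at the norm level, with
level-wise bounds. [folklore] -/
theorem normNE9_of_normCouplingAnalyticRel {I : Set ℝ} {V : ℕ → (ℕ → ℝ) → F} {B : ℕ → ℝ} {c t₀ : ℝ}
    (hI : I.OrdConnected) (ht₀ : 0 < t₀) (hc : 0 < c) (hIt : ∀ s ∈ I, t₀ ≤ s)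
    (hP : ∀ m, ∀ g ∈ BoxWindow I, ∀ g' ∈ BoxWindow I, (∀ n < m, g n = g' n) → V m g = V m g')
    (hA : NormCouplingAnalyticRel I V B c) :
    NormNE9 V (BoxWindow I) fun j _ => 4 * B j / (c * t₀) := by
  intro j g hg g' hg'
  set f : ℕ → F := fun m => V j (hybrid g g' m) with hf
  have h0 : f 0 = V j g := by simp only [hf, hybrid_zero]
  have hfin : f j = V j g' := by
    simp only [hf]
    exact hP j _ (hybrid_mem_boxWindow hg hg' _) _ hg' fun n hn => hybrid_apply_lt g g' hn
  have htel : V j g - V j g' = ∑ m ∈ Finset.range j, (f m - f (m + 1)) := by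
    rw [Finset.sum_range_sub', h0, hfin]
  have hstep : ∀ m ∈ Finset.range j, ‖f m - f (m + 1)‖ ≤ 4 * B j / (c * t₀) * |g m - g' m| := by
    intro m hm
    rw [Finset.mem_range] at hm
    obtain ⟨W, D, hW, hWB, hD, hWV⟩ := hA j (hybrid g g' m) (hybrid_mem_boxWindow hg hg' m) m hm
    have hgm : g m ∈ I := hg m
    have hg'm : g' m ∈ I := hg' m
    have hmin : min (g m) (g' m) ∈ I := by
      rcases min_choice (g m) (g' m) with h | h <;> rw [h] <;> assumption
    have hmax : max (g m) (g' m) ∈ I := by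
      rcases max_choice (g m) (g' m) with h | h <;> rw [h] <;> assumption
    have hDab : ∀ s ∈ Icc (min (g m) (g' m)) (max (g m) (g' m)), closedBall (s : ℂ) (c * t₀) ⊆ D := by
      intro s hs
      have hsI : s ∈ I := hI.out hmin hmax hs
      refine (closedBall_subset_closedBall ?_).trans (hD s hsI)
      calc c * t₀ ≤ c * s := mul_le_mul_of_nonneg_left (hIt s hsI) hc.le
        _ ≤ c * |s| := mul_le_mul_of_nonneg_left (le_abs_self s) hc.le
    have key := real_param_lipschitz (mul_pos hc ht₀) hW hWB hDab
      (s := g m) (t := g' m) ⟨min_le_left _ _, le_max_left _ _⟩ ⟨min_le_right _ _, le_max_right _ _⟩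
    have hWs : W (g m) = f m := by
      rw [hWV (g m) hgm, update_hybrid_self]
    have hWt : W (g' m) = f (m + 1) := by
      rw [hWV (g' m) hg'm, ← hybrid_succ]
    rw [hWs, hWt] at key
    exact key
  calc ‖V j g - V j g'‖ = ‖∑ m ∈ Finset.range j, (f m - f (m + 1))‖ := by rw [htel]
    _ ≤ ∑ m ∈ Finset.range j, ‖f m - f (m + 1)‖ := norm_sum_le _ _
    _ ≤ ∑ m ∈ Finset.range j, 4 * B j / (c * t₀) * |g m - g' m| := Finset.sum_le_sum hstep

/-! ## §4 To the functional: one run (the tower junction is in `TowerCarriersBoxWitness` §5) -/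

/-- **ONE RUN, FUNCTIONAL LEVEL**: propagation hypotheses for the run's activities + inductive bounds `B j ≤ B̄` + an evaluation
`E g U X = ev (V (scale X) g) U X` that is `e^{−κd(X)}`-Lipschitz in the activity (the owner's `ne9_of_normNE9`) ⇒
`T4OutputRate.NE9 E (BoxWindow I) κ (4B̄∕(c t₀))` — BOUNDED, NON-FADING moduli from [H-dil]-STEP + qualitative holomorphy + class reproduction,
no step constant anywhere. [folklore] -/
theorem ne9_boxWindow_of_propagation {C : Carriers} {Bg : Type} {E : Functional C Bg}
    {I : Set ℝ} {V : ℕ → (ℕ → ℝ) → F} {Φ : ℕ → ℂ → F → F} {T : ℕ → (ℕ → F) → F} {A : ℕ → Set F}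
    {B : ℕ → ℝ} {Bbar c t₀ κ : ℝ} (ev : F → Bg → C.Dom → ℝ)
    (hI : I.OrdConnected) (ht₀ : 0 < t₀) (hc : 0 < c) (hIt : ∀ s ∈ I, t₀ ≤ s)
    (hAB : ∀ m, ∀ a ∈ A m, ‖a‖ ≤ B m) (hBbar : ∀ m, B m ≤ Bbar)
    (hP : ∀ m, ∀ g ∈ BoxWindow I, ∀ g' ∈ BoxWindow I, (∀ n < m, g n = g' n) → V m g = V m g')
    (hmem : ∀ m, ∀ g ∈ BoxWindow I, V m g ∈ A m)
    (hrec : ∀ j, ∀ g ∈ BoxWindow I, V (j + 1) g = Φ j (g j : ℂ) (T j fun m => V m g))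
    (hTdep : ∀ j (a a' : ℕ → F), (∀ m ≤ j, a m = a' m) → T j a = T j a')
    (hT : ∀ j (D : Set ℂ) (W : ℕ → ℂ → F), (∀ m ≤ j, DifferentiableOn ℂ (W m) D) →
      DifferentiableOn ℂ (fun z => T j fun m => W m z) D)
    (hold : ∀ j, ∀ s ∈ I, ∃ U : Set F, DifferentiableOn ℂ (Φ j (s : ℂ)) U ∧
      ∀ a : ℕ → F, (∀ m ≤ j, a m ∈ A m) → T j a ∈ U ∧ Φ j (s : ℂ) (T j a) ∈ A (j + 1))
    (hlast : ∀ j, ∀ h ∈ BoxWindow I, ∃ D : Set ℂ, DifferentiableOn ℂ (fun z => Φ j z (T j fun m => V m h)) D ∧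
      (∀ z ∈ D, Φ j z (T j fun m => V m h) ∈ A (j + 1)) ∧ ∀ s ∈ I, closedBall (s : ℂ) (c * |s|) ⊆ D)
    (hev : ∀ (b b' : F) (U : Bg) (X : C.Dom), |ev b U X - ev b' U X| ≤ Real.exp (-(κ * C.d X)) * ‖b - b'‖)
    (hE : ∀ g ∈ BoxWindow I, ∀ (U : Bg) (X : C.Dom), E g U X = ev (V (C.scale X) g) U X) :
    NE9 E (BoxWindow I) κ fun _ _ => 4 * Bbar / (c * t₀) := by
  have hN := normNE9_of_normCouplingAnalyticRel hI ht₀ hc hIt hP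
    (normCouplingAnalyticRel_of_propagation hAB hP hmem hrec hTdep hT hold hlast)
  have hN' : NormNE9 V (BoxWindow I) fun _ _ => 4 * Bbar / (c * t₀) := by
    intro j g hg g' hg'
    refine (hN j g hg g' hg').trans (Finset.sum_le_sum fun i _ => ?_)
    exact mul_le_mul_of_nonneg_right
      (div_le_div_of_nonneg_right (mul_le_mul_of_nonneg_left (hBbar j) (by norm_num)) (mul_pos hc ht₀).le)
      (abs_nonneg _)
  exact ne9_of_normNE9 ev hev hE hN'

end Cauchy

end Summit.QuantumFields.BalabanUV.T4Continuum.NE9.AnalyticBranchPropagation
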